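/-
VALUE = THEOREM, NOT summit progress (cell b2b-lgcu-borel, gen 25); crux 14079 untouched.
-/
import Mathlib
import Summits.MatrixMultiplication.MatrixMultiplication.Theorems.SubgroupIdentityDesigns.Negative.TransvectionPairGL2
import Summits.MatrixMultiplication.MatrixMultiplication.Theorems.SubgroupIdentityDesigns.Negative.ParabolicSubgroup

/-!
# Class-(S) members fix no plane: two order-`p` subgroups in a plane stabiliser of `GL₃(𝔽_p)`
# force a transvection

VALUE = THEOREM (structure law feeding the case-(S) analysis of HYPOTHETICAL level-one witnesses
of the crux `SubgroupIdentityDesigns`, `m = 3`, `k = 1`), NOT summit progress.  The crux item is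
neither restated nor weakened; this file is a `--supports` helper under `Negative/`.

THEOREM (`no_plane_two_sylow`, every odd prime `p`, pure group theory — no TPP, no design).
Let `T₁ ≠ T₂` be subgroups of order `p` of `GL₃(𝔽_p)` such that `J = T₁ ⊔ T₂` lies in the
stabiliser `P³₂` of the plane `⟨e₀, e₁⟩` (`ParabolicSubgroup.parab (ZMod p) 3 2`), satisfies the
member window `|J| + 3 ≤ p³`, and contains no quadratic unipotent `h ≠ 1`, `(h − 1)² = 0`.  Then
`False`.  (`no_plane_of_classS`: the same for any `J ≤ P³₂` in the window containing `T₁, T₂`.)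

PROOF.  Let `φ : P³₂ → GL₂(𝔽_p)` be the action on the plane (`ParabolicSubgroup.ul`).  An element
of `J` acts on `e₂ (mod plane)` by a scalar `h₂₂`, which is `1` on `T₁ ∪ T₂` (order `p`) hence on
`J`.  (A) `h ∈ J`, `φ h = 1` ⇒ `(h − 1)² = 0` ⇒ `h = 1`: so `φ` is injective on each `Tᵢ`, the
images `T̄ᵢ` have order `p`, and `T̄₁ ≠ T̄₂` (else `t₁⁻¹ t₂ ∈ ker`, `T₁ ∩ T₂ ≠ 1`).  (B) By
`TransvectionPairGL2` the image `φ(J)` contains a conjugate of `SL₂(𝔽_p)`, so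
`|φ(J)| ≥ p (p² − 1)`; with `|J| = |ker φ|_J| · |φ(J)| ≤ p³ − 3 < 2 p (p² − 1)` the kernel is
trivial.  (C) The central involution `−1 ∈ SL₂(𝔽_p)` lifts to `s ∈ J`, `φ s = −1`, `s₂₂ = 1`,
central in `J` by injectivity.  For `u ∈ T₁ ∖ 1` (`ū = φ u` a transvection, `(ū − 1)² = 0`) the
relation `s u = u s` reads `2 c_u = (1 − ū) c_s` on the last column, whence
`(u − 1)² = [[(ū−1)², (ū−1) c_u], [0, 0]] = 0` — a quadratic unipotent in `J`, contradiction.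

USE (successor target S-16, ORACLE-g25 §G25-5).  A case-(S) member of a `(3,1)`-witness
(`MemberTrichotomy.member_classification`: Sylow subgroups of order `p`, at least `p + 1` of them,
no quadratic unipotent; member window from `NormalSylowLaw`) therefore fixes no plane of `𝔽_p³`
(after conjugating the plane to `⟨e₀, e₁⟩`); the dual statement for lines follows by applying this
result to the contragredient `h ↦ (hᵀ)⁻¹`.  Both wrappers are left to the successor.

HONEST SCOPE.  Group theory of `GL₃(𝔽_p)`; no `(p, ε)` cell is emptied.  Sorry-free; standard
axioms.
-/

set_option linter.dupNamespace false

noncomputable section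

open scoped BigOperators Classical Matrix

namespace Summit.MatrixMultiplication.MatrixMultiplication.Theorems.SubgroupIdentityDesigns.Negative
namespace PlaneFreeClassS

open Summit.MatrixMultiplication.MatrixMultiplication.Theorems.LieRankDesigns.Negative (GLm Mat)
open CuspidalObstruction (SL2)
open ParabolicSubgroup (parab mem_parab ul ul_apply)

variable {p : ℕ} [hp : Fact p.Prime]

/-! ## 1. The plane stabiliser `P³₂`, its block `φ` and the corner character `h₂₂` -/

section Parab

/-- The action of the plane stabiliser `P³₂ ≤ GL₃(𝔽_p)` on its plane `⟨e₀, e₁⟩`. -/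
def φ : ↥(parab (ZMod p) 3 2) →* GLm p 2 := ul (show (2 : ℕ) ≤ 3 by norm_num)

/-- Entries of `φ g`: the upper-left block. -/
theorem φ_apply (g : ↥(parab (ZMod p) 3 2)) (s t : Fin 2) :
    ((φ g : GLm p 2) : Mat p 2) s t =
      ((g : GLm p 3) : Mat p 3) (Fin.castLE (show (2 : ℕ) ≤ 3 by norm_num) s)
        (Fin.castLE (show (2 : ℕ) ≤ 3 by norm_num) t) := rfl

/-- The corner entries of an element of `P³₂` vanish: `g₂₀ = 0`. -/
theorem e20 {g : GLm p 3} (hg : g ∈ parab (ZMod p) 3 2) : (g : Mat p 3) 2 0 = 0 :=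
  mem_parab.mp hg 2 0 (by norm_num) (by norm_num)

/-- `g₂₁ = 0` for `g ∈ P³₂`. -/
theorem e21 {g : GLm p 3} (hg : g ∈ parab (ZMod p) 3 2) : (g : Mat p 3) 2 1 = 0 :=
  mem_parab.mp hg 2 1 (by norm_num) (by norm_num)

/-- The corner character is multiplicative on `P³₂`: `(g h)₂₂ = g₂₂ h₂₂`. -/
theorem e22_mul {g h : GLm p 3} (hg : g ∈ parab (ZMod p) 3 2) :
    ((g * h : GLm p 3) : Mat p 3) 2 2 = (g : Mat p 3) 2 2 * (h : Mat p 3) 2 2 := by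
  rw [Units.val_mul, Matrix.mul_apply, Fin.sum_univ_three, e20 hg, e21 hg]; ring

/-- `(g⁻¹)₂₂ g₂₂ = 1`. -/
theorem e22_inv_mul {g : GLm p 3} (hg : g ∈ parab (ZMod p) 3 2) :
    ((g⁻¹ : GLm p 3) : Mat p 3) 2 2 * (g : Mat p 3) 2 2 = 1 := by
  rw [← e22_mul ((parab (ZMod p) 3 2).inv_mem hg), inv_mul_cancel, Units.val_one,
    Matrix.one_apply_eq]

/-- `(g ^ k)₂₂ = g₂₂ ^ k`. -/
theorem e22_pow {g : GLm p 3} (hg : g ∈ parab (ZMod p) 3 2) (k : ℕ) :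
    ((g ^ k : GLm p 3) : Mat p 3) 2 2 = ((g : Mat p 3) 2 2) ^ k := by
  induction k with
  | zero => simp
  | succ k ih => rw [pow_succ, e22_mul ((parab (ZMod p) 3 2).pow_mem hg k), ih, pow_succ]

/-- An element of `P³₂` with `g ^ p = 1` has corner entry `g₂₂ = 1` (Fermat). -/
theorem e22_of_pow_prime {g : GLm p 3} (hg : g ∈ parab (ZMod p) 3 2) (hgp : g ^ p = 1) :
    (g : Mat p 3) 2 2 = 1 := by
  have h := e22_pow hg p
  rw [hgp, Units.val_one, Matrix.one_apply_eq, ZMod.pow_card] at h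
  exact h.symm

/-- **(A)** An element of `P³₂` acting trivially on the plane and with corner entry `1` is a
quadratic unipotent: `(h − 1)² = 0`. -/
theorem sq_zero_of_block_one (g : ↥(parab (ZMod p) 3 2)) (hφ : φ g = 1)
    (h22 : ((g : GLm p 3) : Mat p 3) 2 2 = 1) :
    (((g : GLm p 3) : Mat p 3) - 1) * (((g : GLm p 3) : Mat p 3) - 1) = 0 := by
  have hb : ∀ s t : Fin 2, ((g : GLm p 3) : Mat p 3) (Fin.castLE (show (2 : ℕ) ≤ 3 by norm_num) s)
      (Fin.castLE (show (2 : ℕ) ≤ 3 by norm_num) t) = if s = t then 1 else 0 := by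
    intro s t
    rw [← φ_apply, hφ, Units.val_one, Matrix.one_apply]
  have h00 : ((g : GLm p 3) : Mat p 3) 0 0 = 1 := by simpa using hb 0 0
  have h01 : ((g : GLm p 3) : Mat p 3) 0 1 = 0 := by simpa using hb 0 1
  have h10 : ((g : GLm p 3) : Mat p 3) 1 0 = 0 := by simpa using hb 1 0
  have h11 : ((g : GLm p 3) : Mat p 3) 1 1 = 1 := by simpa using hb 1 1
  have h20 := e20 g.2
  have h21 := e21 g.2
  ext i j
  fin_cases i <;> fin_cases j <;>
    simp [Matrix.mul_apply, Fin.sum_univ_three, h00, h01, h10, h11, h20, h21, h22]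

end Parab

/-! ## 2. Subgroups of order `p` and the block map on `J ≤ P³₂` -/

section Main

omit hp in
/-- An element of a subgroup of order `p` satisfies `t ^ p = 1`. -/
theorem pow_prime_eq_one_of_mem {T : Subgroup (GLm p 3)} (hT : Nat.card T = p) {t : GLm p 3}
    (ht : t ∈ T) : t ^ p = 1 := by
  have h : (⟨t, ht⟩ : ↥T) ^ Nat.card ↥T = 1 := pow_card_eq_one'
  rw [hT] at h
  simpa using congrArg Subtype.val h

/-- The block map restricted to a subgroup `J` of the plane stabiliser. -/
def ψ {J : Subgroup (GLm p 3)} (hJP : J ≤ parab (ZMod p) 3 2) : ↥J →* GLm p 2 :=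
  φ.comp (Subgroup.inclusion hJP)

/-- The four entries of `ψ x` are the upper-left entries of `x`. -/
theorem ψ_entries {J : Subgroup (GLm p 3)} (hJP : J ≤ parab (ZMod p) 3 2) (x : ↥J) :
    ((ψ hJP x : GLm p 2) : Mat p 2) 0 0 = ((x : GLm p 3) : Mat p 3) 0 0 ∧
      ((ψ hJP x : GLm p 2) : Mat p 2) 0 1 = ((x : GLm p 3) : Mat p 3) 0 1 ∧
      ((ψ hJP x : GLm p 2) : Mat p 2) 1 0 = ((x : GLm p 3) : Mat p 3) 1 0 ∧
      ((ψ hJP x : GLm p 2) : Mat p 2) 1 1 = ((x : GLm p 3) : Mat p 3) 1 1 :=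
  ⟨rfl, rfl, rfl, rfl⟩

/-- On `J = T₁ ⊔ T₂ ≤ P³₂` (`|Tᵢ| = p`) the corner character is trivial: `g₂₂ = 1`. -/
theorem e22_eq_one_of_mem_sup {T₁ T₂ : Subgroup (GLm p 3)} (hT₁ : Nat.card T₁ = p)
    (hT₂ : Nat.card T₂ = p) (hJP : T₁ ⊔ T₂ ≤ parab (ZMod p) 3 2) {g : GLm p 3}
    (hg : g ∈ T₁ ⊔ T₂) : (g : Mat p 3) 2 2 = 1 := by
  rw [Subgroup.sup_eq_closure] at hg
  refine Subgroup.closure_induction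
    (p := fun (h : GLm p 3) _ => ((h : GLm p 3) : Mat p 3) 2 2 = 1) ?_ ?_ ?_ ?_ hg
  · intro x hx
    rcases hx with hx | hx
    · exact e22_of_pow_prime (hJP (Subgroup.mem_sup_left hx)) (pow_prime_eq_one_of_mem hT₁ hx)
    · exact e22_of_pow_prime (hJP (Subgroup.mem_sup_right hx)) (pow_prime_eq_one_of_mem hT₂ hx)
  · simp
  · intro x y hx _ ihx ihy
    have hxP : x ∈ parab (ZMod p) 3 2 := hJP (by rwa [Subgroup.sup_eq_closure])
    rw [e22_mul hxP, ihx, ihy, mul_one]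
  · intro x hx ih
    have hxP : x ∈ parab (ZMod p) 3 2 := hJP (by rwa [Subgroup.sup_eq_closure])
    have h := e22_inv_mul hxP
    rwa [ih, mul_one] at h

variable {J : Subgroup (GLm p 3)}

/-- **(A) in `J`**: trivial block and trivial corner force `x = 1` when `J` has no quadratic
unipotent. -/
theorem eq_one_of_ψ (hJP : J ≤ parab (ZMod p) 3 2)
    (hnq : ∀ h ∈ J, ((h : Mat p 3) - 1) * ((h : Mat p 3) - 1) = 0 → h = 1) (x : ↥J)
    (hψ : ψ hJP x = 1) (h22 : ((x : GLm p 3) : Mat p 3) 2 2 = 1) : x = 1 := by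
  have hsq := sq_zero_of_block_one ⟨(x : GLm p 3), hJP x.2⟩ hψ h22
  exact Subtype.ext (hnq _ x.2 hsq)

/-- The image of an order-`p` subgroup `T ≤ J` under `ψ` has order `p`. -/
theorem card_map_eq (hJP : J ≤ parab (ZMod p) 3 2)
    (hnq : ∀ h ∈ J, ((h : Mat p 3) - 1) * ((h : Mat p 3) - 1) = 0 → h = 1)
    (h22J : ∀ g ∈ J, (g : Mat p 3) 2 2 = 1) {T : Subgroup (GLm p 3)} (hT : Nat.card T = p)
    (hTJ : T ≤ J) : Nat.card ((T.subgroupOf J).map (ψ hJP)) = p := by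
  have hcT : Nat.card (T.subgroupOf J) = p :=
    (Nat.card_congr (Subgroup.subgroupOfEquivOfLe hTJ).toEquiv).trans hT
  have hdvd : Nat.card ((T.subgroupOf J).map (ψ hJP)) ∣ p := by
    have h := Subgroup.card_map_dvd (T.subgroupOf J) (ψ hJP)
    rwa [hcT] at h
  rcases (Nat.dvd_prime hp.out).mp hdvd with h1 | hpp
  · exfalso
    have hbot : (T.subgroupOf J).map (ψ hJP) = ⊥ := Subgroup.eq_bot_of_card_eq _ h1
    have hT1 : T = ⊥ := by
      refine (Subgroup.eq_bot_iff_forall _).mpr fun t ht => ?_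
      have hx : (⟨t, hTJ ht⟩ : ↥J) ∈ T.subgroupOf J := Subgroup.mem_subgroupOf.mpr ht
      have hm : ψ hJP ⟨t, hTJ ht⟩ ∈ (T.subgroupOf J).map (ψ hJP) := Subgroup.mem_map_of_mem _ hx
      rw [hbot, Subgroup.mem_bot] at hm
      exact congrArg Subtype.val (eq_one_of_ψ hJP hnq ⟨t, hTJ ht⟩ hm (h22J t (hTJ ht)))
    rw [hT1, Subgroup.card_bot] at hT
    exact hp.out.one_lt.ne hT
  · exact hpp

/-- Distinct order-`p` subgroups of `J` have distinct images under `ψ`. -/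
theorem map_ne (hJP : J ≤ parab (ZMod p) 3 2)
    (hnq : ∀ h ∈ J, ((h : Mat p 3) - 1) * ((h : Mat p 3) - 1) = 0 → h = 1)
    (h22J : ∀ g ∈ J, (g : Mat p 3) 2 2 = 1) {T₁ T₂ : Subgroup (GLm p 3)}
    (hT₁ : Nat.card T₁ = p) (hT₂ : Nat.card T₂ = p) (hne : T₁ ≠ T₂) (h₁ : T₁ ≤ J) :
    (T₁.subgroupOf J).map (ψ hJP) ≠ (T₂.subgroupOf J).map (ψ hJP) := by
  intro heq
  have hT₁b : T₁ ≠ ⊥ :=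
    (Subgroup.one_lt_card_iff_ne_bot _).mp (by rw [hT₁]; exact hp.out.one_lt)
  obtain ⟨⟨t₁, ht₁⟩, ht₁1⟩ := Subgroup.ne_bot_iff_exists_ne_one.mp hT₁b
  have hm : ψ hJP ⟨t₁, h₁ ht₁⟩ ∈ (T₂.subgroupOf J).map (ψ hJP) := by
    rw [← heq]; exact Subgroup.mem_map_of_mem _ (Subgroup.mem_subgroupOf.mpr ht₁)
  obtain ⟨x, hx, hxe⟩ := Subgroup.mem_map.mp hm
  have hk : ψ hJP ((⟨t₁, h₁ ht₁⟩ : ↥J)⁻¹ * x) = 1 := by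
    rw [map_mul, map_inv, hxe, inv_mul_cancel]
  have hk1 := eq_one_of_ψ hJP hnq _ hk (h22J _ ((⟨t₁, h₁ ht₁⟩ : ↥J)⁻¹ * x).2)
  have hxt : x = ⟨t₁, h₁ ht₁⟩ := (inv_mul_eq_one.mp hk1).symm
  have ht₁T₂ : t₁ ∈ T₂ := by
    have h := Subgroup.mem_subgroupOf.mp hx
    rwa [hxt] at h
  have hinf : Nat.card ↥(T₁ ⊓ T₂) = p := by
    have hdvd : Nat.card ↥(T₁ ⊓ T₂) ∣ p := by
      have h := Subgroup.card_dvd_of_le (inf_le_left : T₁ ⊓ T₂ ≤ T₁)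
      rwa [hT₁] at h
    rcases (Nat.dvd_prime hp.out).mp hdvd with h1 | hpp
    · exfalso
      have hbot := Subgroup.eq_bot_of_card_eq _ h1
      have h : t₁ ∈ T₁ ⊓ T₂ := Subgroup.mem_inf.mpr ⟨ht₁, ht₁T₂⟩
      rw [hbot, Subgroup.mem_bot] at h
      exact ht₁1 (Subtype.ext h)
    · exact hpp
  have h12 : T₁ ⊓ T₂ = T₁ := Subgroup.eq_of_le_of_card_ge inf_le_left (by rw [hinf, hT₁])
  exact hne (Subgroup.eq_of_le_of_card_ge (inf_eq_left.mp h12) (by rw [hT₁, hT₂]))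

/-! ## 3. The theorem -/

/-- **Two order-`p` subgroups in the plane stabiliser force a transvection.**  `p` odd;
`T₁ ≠ T₂ ≤ GL₃(𝔽_p)` of order `p` with `J = T₁ ⊔ T₂ ≤ P³₂` (the stabiliser of `⟨e₀, e₁⟩`),
`|J| + 3 ≤ p³`, and no quadratic unipotent in `J` — impossible. -/
theorem no_plane_two_sylow (hp2 : p ≠ 2) {T₁ T₂ : Subgroup (GLm p 3)} (hT₁ : Nat.card T₁ = p)
    (hT₂ : Nat.card T₂ = p) (hne : T₁ ≠ T₂) (hJP : T₁ ⊔ T₂ ≤ parab (ZMod p) 3 2)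
    (hJ : Nat.card ↥(T₁ ⊔ T₂) + 3 ≤ p ^ 3)
    (hnq : ∀ h ∈ T₁ ⊔ T₂, ((h : Mat p 3) - 1) * ((h : Mat p 3) - 1) = 0 → h = 1) : False := by
  have h2 : (2 : ZMod p) ≠ 0 := by
    have h : ((2 : ℕ) : ZMod p) ≠ 0 := by
      rw [Ne, ZMod.natCast_eq_zero_iff]
      exact fun h => hp2 ((Nat.prime_dvd_prime_iff_eq hp.out Nat.prime_two).mp h)
    exact_mod_cast h
  have h22J : ∀ g ∈ T₁ ⊔ T₂, (g : Mat p 3) 2 2 = 1 := fun g hg =>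
    e22_eq_one_of_mem_sup hT₁ hT₂ hJP hg
  have h₁ : T₁ ≤ T₁ ⊔ T₂ := le_sup_left
  have h₂ : T₂ ≤ T₁ ⊔ T₂ := le_sup_right
  have hc₁ := card_map_eq hJP hnq h22J hT₁ h₁
  have hc₂ := card_map_eq hJP hnq h22J hT₂ h₂
  have hne' := map_ne hJP hnq h22J hT₁ hT₂ hne h₁
  -- (B) the image contains a conjugate of SL₂, the kernel is trivial
  have hR : p * (p ^ 2 - 1) ≤ Nat.card (ψ hJP).range :=
    TransvectionPairGL2.le_card_of_two_subgroups _ _ _ hc₁ hc₂ hne' (Subgroup.map_le_range _ _)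
      (Subgroup.map_le_range _ _)
  have hker : (ψ hJP).ker = ⊥ := by
    by_contra hk
    have h2k : 1 < Nat.card (ψ hJP).ker := (Subgroup.one_lt_card_iff_ne_bot _).mpr hk
    have hcardJ : Nat.card ↥(T₁ ⊔ T₂) = Nat.card (ψ hJP).range * Nat.card (ψ hJP).ker := by
      rw [Subgroup.card_eq_card_quotient_mul_card_subgroup (ψ hJP).ker,
        Nat.card_congr (QuotientGroup.quotientKerEquivRange (ψ hJP)).toEquiv]
    have hp2' := hp.out.two_le
    have hsq : 4 ≤ p ^ 2 := by nlinarith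
    have hA : p ≤ p * (p ^ 2 - 1) := Nat.le_mul_of_pos_right _ (by omega)
    have h1 : p * (p ^ 2 - 1) + p = p ^ 3 := by
      have h := Nat.sub_add_cancel (Nat.one_le_pow 2 p hp.out.pos)
      calc p * (p ^ 2 - 1) + p = p * (p ^ 2 - 1 + 1) := by ring
        _ = p ^ 3 := by rw [h]; ring
    have hge : p * (p ^ 2 - 1) * 2 ≤ Nat.card ↥(T₁ ⊔ T₂) := by
      rw [hcardJ]; exact Nat.mul_le_mul hR h2k
    omega
  have hinj : Function.Injective (ψ hJP) := (MonoidHom.ker_eq_bot_iff _).mp hker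
  -- (C) the central involution
  obtain ⟨g, hg⟩ := TransvectionPairGL2.exists_conj_sl2_subset _ _ _ hc₁ hc₂ hne'
    (Subgroup.map_le_range _ _) (Subgroup.map_le_range _ _)
  have hdet : Matrix.det (-1 : Mat p 2) = 1 := by simp [Matrix.det_neg]
  obtain ⟨s, hs⟩ := MonoidHom.mem_range.mp (hg ⟨-1, hdet⟩)
  have hsval : ((ψ hJP s : GLm p 2) : Mat p 2) = -1 := by
    rw [hs, Units.val_mul, Units.val_mul, Matrix.SpecialLinearGroup.coe_GL_coe_matrix,
      show (((⟨-1, hdet⟩ : SL2 p)) : Mat p 2) = -1 from rfl, Matrix.mul_neg, Matrix.mul_one,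
      Matrix.neg_mul, ← Units.val_mul, mul_inv_cancel, Units.val_one]
  have hcomm : ∀ u : ↥(T₁ ⊔ T₂), s * u = u * s := fun u => hinj (by
    rw [map_mul, map_mul]
    refine Units.ext ?_
    rw [Units.val_mul, Units.val_mul, hsval, Matrix.neg_mul, Matrix.one_mul, Matrix.mul_neg,
      Matrix.mul_one])
  -- a non-trivial element of T₁ and the matrices
  have hT₁b : T₁ ≠ ⊥ :=
    (Subgroup.one_lt_card_iff_ne_bot _).mp (by rw [hT₁]; exact hp.out.one_lt)
  obtain ⟨⟨u, hu⟩, hu1⟩ := Subgroup.ne_bot_iff_exists_ne_one.mp hT₁b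
  set uJ : ↥(T₁ ⊔ T₂) := ⟨u, h₁ hu⟩ with huJ
  set U : Mat p 3 := ((u : GLm p 3) : Mat p 3) with hUdef
  set S : Mat p 3 := (((s : ↥(T₁ ⊔ T₂)) : GLm p 3) : Mat p 3) with hSdef
  have hU20 : U 2 0 = 0 := e20 (hJP (h₁ hu))
  have hU21 : U 2 1 = 0 := e21 (hJP (h₁ hu))
  have hU22 : U 2 2 = 1 := h22J u (h₁ hu)
  have hS20 : S 2 0 = 0 := e20 (hJP s.2)
  have hS21 : S 2 1 = 0 := e21 (hJP s.2)
  have hS22 : S 2 2 = 1 := h22J _ s.2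
  obtain ⟨hs00, hs01, hs10, hs11⟩ := ψ_entries hJP s
  have hS00 : S 0 0 = -1 := by
    have h := congrFun (congrFun hsval 0) 0; rw [hs00] at h; simpa using h
  have hS01 : S 0 1 = 0 := by
    have h := congrFun (congrFun hsval 0) 1; rw [hs01] at h; simpa using h
  have hS10 : S 1 0 = 0 := by
    have h := congrFun (congrFun hsval 1) 0; rw [hs10] at h; simpa using h
  have hS11 : S 1 1 = -1 := by
    have h := congrFun (congrFun hsval 1) 1; rw [hs11] at h; simpa using h
  -- the block of u is a quadratic unipotent
  have hup : (u : GLm p 3) ^ p = 1 := pow_prime_eq_one_of_mem hT₁ hu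
  have huJp : uJ ^ p = 1 := Subtype.ext (by simp [huJ, hup])
  have hψp : (ψ hJP uJ) ^ p = 1 := by rw [← map_pow, huJp, map_one]
  have hq := TransvectionPairGL2.mul_self_eq_zero ⟨p, TransvectionPairGL2.sub_one_pow_prime hψp⟩
  have hB : ((ψ hJP uJ : GLm p 2) : Mat p 2) = !![U 0 0, U 0 1; U 1 0, U 1 1] := by
    ext i j; fin_cases i <;> fin_cases j <;> rfl
  rw [hB] at hq
  have q00 : (U 0 0 - 1) * (U 0 0 - 1) + U 0 1 * U 1 0 = 0 := by
    have h := congrFun (congrFun hq 0) 0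
    simpa [Matrix.mul_apply, Fin.sum_univ_two, Matrix.one_apply] using h
  have q01 : (U 0 0 - 1) * U 0 1 + U 0 1 * (U 1 1 - 1) = 0 := by
    have h := congrFun (congrFun hq 0) 1
    simpa [Matrix.mul_apply, Fin.sum_univ_two, Matrix.one_apply] using h
  have q10 : U 1 0 * (U 0 0 - 1) + (U 1 1 - 1) * U 1 0 = 0 := by
    have h := congrFun (congrFun hq 1) 0
    simpa [Matrix.mul_apply, Fin.sum_univ_two, Matrix.one_apply] using h
  have q11 : U 1 0 * U 0 1 + (U 1 1 - 1) * (U 1 1 - 1) = 0 := by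
    have h := congrFun (congrFun hq 1) 1
    simpa [Matrix.mul_apply, Fin.sum_univ_two, Matrix.one_apply] using h
  -- the commutation relation on the last column
  have hSU : S * U = U * S := by
    have h := congrArg (fun x : ↥(T₁ ⊔ T₂) => ((x : GLm p 3) : Mat p 3)) (hcomm uJ)
    simpa using h
  have e02 := congrFun (congrFun hSU 0) 2
  have e12 := congrFun (congrFun hSU 1) 2
  simp only [Matrix.mul_apply, Fin.sum_univ_three] at e02 e12
  rw [hS00, hS01, hU22, hS22] at e02
  rw [hS10, hS11, hU22, hS22] at e12
  have hG : (U 0 0 - 1) * U 0 2 + U 0 1 * U 1 2 = 0 := by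
    have h2G : (2 : ZMod p) * ((U 0 0 - 1) * U 0 2 + U 0 1 * U 1 2) = 0 := by
      linear_combination (-(S 0 2)) * q00 + (-(S 1 2)) * q01 + (-(U 0 0 - 1)) * e02 +
        (-(U 0 1)) * e12
    rcases mul_eq_zero.mp h2G with h | h
    · exact absurd h h2
    · exact h
  have hG' : U 1 0 * U 0 2 + (U 1 1 - 1) * U 1 2 = 0 := by
    have h2G : (2 : ZMod p) * (U 1 0 * U 0 2 + (U 1 1 - 1) * U 1 2) = 0 := by
      linear_combination (-(S 0 2)) * q10 + (-(S 1 2)) * q11 + (-(U 1 0)) * e02 +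
        (-(U 1 1 - 1)) * e12
    rcases mul_eq_zero.mp h2G with h | h
    · exact absurd h h2
    · exact h
  -- hence (u - 1)² = 0: a quadratic unipotent in J
  have hsq : (U - 1) * (U - 1) = 0 := by
    ext i j
    fin_cases i <;> fin_cases j <;>
      simp [Matrix.mul_apply, Fin.sum_univ_three, Matrix.one_apply, hU20, hU21, hU22]
    · linear_combination q00
    · linear_combination q01
    · linear_combination hG
    · linear_combination q10
    · linear_combination q11
    · linear_combination hG'
  exact hu1 (Subtype.ext (hnq u (h₁ hu) hsq))

/-- **Corollary (any `J`).**  A subgroup `J` of the plane stabiliser `P³₂` with `|J| + 3 ≤ p³`,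
no quadratic unipotent, and two distinct subgroups of order `p` does not exist (`p` odd). -/
theorem no_plane_of_classS (hp2 : p ≠ 2) (J T₁ T₂ : Subgroup (GLm p 3))
    (hJP : J ≤ parab (ZMod p) 3 2) (hJ : Nat.card J + 3 ≤ p ^ 3)
    (hnq : ∀ h ∈ J, ((h : Mat p 3) - 1) * ((h : Mat p 3) - 1) = 0 → h = 1)
    (hT₁ : Nat.card T₁ = p) (hT₂ : Nat.card T₂ = p) (hne : T₁ ≠ T₂) (h₁ : T₁ ≤ J)
    (h₂ : T₂ ≤ J) : False := by
  have hle : T₁ ⊔ T₂ ≤ J := sup_le h₁ h₂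
  exact no_plane_two_sylow hp2 hT₁ hT₂ hne (hle.trans hJP)
    (le_trans (Nat.add_le_add_right (Subgroup.card_le_of_le hle) 3) hJ)
    fun h hh => hnq h (hle hh)

end Main

end PlaneFreeClassS
end Summit.MatrixMultiplication.MatrixMultiplication.Theorems.SubgroupIdentityDesigns.Negative
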